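import Literature.Analysis.InnerProduct.HilbertComplexEigenvalueComparisonMiddle
import Literature.Analysis.InnerProduct.EigenvalueCountingFunctionComparison
import HarnessLib

/-!
# Invariance of heat-trace estimates under isomorphisms of Hilbert complexes (Brüning–Lesch 1992, Corollary 2.18):
# `tr e^{-tΔ} ≤ Ct^{-α}` for `0 < t ≤ 1` implies `tr e^{-tΔ′} ≤ C′t^{-α}` for every isomorphic complex

Layer `Literature/Analysis/InnerProduct`, namespace `Literature.Analysis.InnerProduct`; sequel BY NAME of
`HilbertComplexEigenvalueComparison.lean` / `HilbertComplexEigenvalueComparisonMiddle.lean` (rows g34-#7/#8: Lemma 2.17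
(2.52) in counting form for `T*T`, `SS*` and `□ = TT* + S*S` under an isomorphism of discrete complexes —
`ncard_eigenvalue_adjointCompSelf_lt_le_of_iso`, `ncard_eigenvalue_selfCompAdjoint_lt_le_of_iso`,
`ncard_eigenvalue_laplacian_comparison_of_iso`), `EigenvalueCountingFunctionComparison.lean` (row g35-#1: the passage from
the counting comparison to heat traces, `summable_and_tsum_exp_neg_mul_le_of_forall_ncard_setOf_lt_le`,
`tsum_exp_neg_mul_le_mul_rpow_neg_of_forall_ncard_setOf_lt_le`, `ncard_setOf_lt_le_of_le_of_forall_ncard_setOf_lt_le`),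
`HilbertComplexLaplacianDiagonal.lean` (`eigenvalue_nonneg`) and `HilbertComplexEigenspaceSupersymmetry.lean` (the
zero-end bridges `laplacian_domain_iff_of_adjointCompSelf` / `…_of_selfCompAdjoint`). Lane `lit-hodgefound` (Track 2
foundations library), prover seat `lit-hodgefound-p06` (generation 35), self-proposed row g35-#2. THEOREMS ONLY (no
definition, no instance, no named fact). As in `HilbertComplexHeatTrace.lean` the heat trace of a Laplacian with an
eigenbasis `Δeᵢ = μᵢeᵢ` is the real series `∑' i, e^{-tμᵢ}` under the HYPOTHESIS that it converges; the Laplacians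
are hypothesis-parametrised (`hdomA`/`hvalA` for `T*T`, `hdom`/`hval` for `□`, `hdomC`/`hvalC` for `SS*`), discreteness
is a Hilbert basis of eigenvectors with `μᵢ → ∞`, on BOTH complexes; an isomorphism of complexes is a pair of maps of
complexes `(g_E, g_F, g_G) ⇄ (k_E, k_F, k_G)`, inverse to each other, with `‖g‖ ≤ M_g`, `‖k‖ ≤ M_k`.

## Source, verbatim

J. Brüning, M. Lesch, *Hilbert complexes*, J. Funct. Anal. 108 (1992) 88–132, §2 p. 104 (held text
`paper:doi-10-1016-0022-1236-92-90147-b`, p0017), after Lemma 2.17 ("`C⁻¹λₙ ≤ λ′ₙ ≤ Cλₙ`, `n ≥ 1` (2.52)"):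

"As a useful consequence we note the invariance of trace estimates for the heat kernel.
COROLLARY 2.18. Assume that the Laplacian `Δ` of `(𝒟, D)` satisfies `tr e^{-tΔ} ≤ Ct^{-α}` for `0 < t ≤ 1`. If there
is a complex isomorphism `g : (𝒟, D) → (𝒟′, D′)`, then we have also `tr e^{-tΔ′} ≤ C′t^{-α}`, `0 < t ≤ 1`."

Here `Δ = ⊕ᵢ Δᵢ` (BL92 (2.9)); for the short complex `0 → E →T F →S G → 0` the three Laplacians are `Δ₀ = T*T`,
`Δ₁ = □ = TT* + S*S`, `Δ₂ = SS*`, and `tr e^{-tΔ} = ∑ᵢ tr e^{-tΔᵢ}`. The proof (not printed) is: by (2.52) with the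
comparison constant `C_iso` (which may be taken `≥ 1`), `tr e^{-tΔ′} = ∑ e^{-tλ′ₙ} ≤ ∑ e^{-(t/C_iso)λₙ} =
tr e^{-(t/C_iso)Δ} ≤ C (t/C_iso)^{-α} = C·C_iso^α·t^{-α}` for `0 < t ≤ 1`; we record the intermediate DOMINATION
`tr e^{-tΔ′} ≤ tr e^{-(t/C_iso)Δ}` (valid for all `t ≥ 0` whenever the right side converges) and allow any `t₀` in place
of `1`. The comparison constant is `C_iso = max((M_g M_k)², 1)`.

## What is proved (all over `𝕜 = ℝ` or `ℂ`)

* §0 **`eigenvalue_adjointCompSelf_nonneg`**, **`eigenvalue_selfCompAdjoint_nonneg`** (eigenvalues of `T*T` and of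
  `SS*` are `≥ 0`, through the bridges to `eigenvalue_nonneg`).
* §1 (`Δ₀ = T*T`) **`summable_and_tsum_exp_neg_mul_adjointCompSelf_le_of_iso`** (domination with summability transfer),
  **`tsum_exp_neg_mul_adjointCompSelf_le_mul_rpow_neg_of_iso`** (Cor 2.18 in degree `0`).
* §2 (`Δ₂ = SS*`) **`summable_and_tsum_exp_neg_mul_selfCompAdjoint_le_of_iso`**,
  **`tsum_exp_neg_mul_selfCompAdjoint_le_mul_rpow_neg_of_iso`**.
* §3 (`Δ₁ = □`) **`summable_and_tsum_exp_neg_mul_laplacian_le_of_iso`**,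
  **`tsum_exp_neg_mul_laplacian_le_mul_rpow_neg_of_iso`**.
* §4 (`Δ = Δ₀ ⊕ Δ₁ ⊕ Δ₂`) **`heatTrace_complex_le_of_iso`** (domination of the total heat trace
  `θ_E + θ_F + θ_G`), **`heatTrace_complex_le_mul_rpow_neg_of_iso`** (COROLLARY 2.18 as printed, `C′ = C·C_iso^α`).

## References

* [BruningLesch1992] J. Brüning, M. Lesch, *Hilbert complexes*, J. Funct. Anal. 108 (1992) 88–132, §2 Lemma 2.17
  (2.52), Corollary 2.18, p. 104; (2.9) (`Δ = ⊕ Δᵢ`).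
* [Kato1966] T. Kato, *Perturbation Theory for Linear Operators* (1966), V §3.7 Thm 3.24 (`T*T` is self-adjoint and
  non-negative).
* [Gilkey1995] P. B. Gilkey, *Invariance theory, the heat equation, and the Atiyah–Singer index theorem*, 2nd ed. (1995),
  §1.6 Lemma 1.6.5 (`Tr e^{-tΔᵢ} = ∑ e^{-tλₙ}`; through `HilbertComplexHeatTrace.lean`).
-/

noncomputable section

open scoped InnerProductSpace LinearPMap
open Filter Topology

namespace Literature.Analysis.InnerProduct

variable {𝕜 E F G E' F' G' : Type*} [RCLike 𝕜]
variable [NormedAddCommGroup E] [InnerProductSpace 𝕜 E]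
variable [NormedAddCommGroup F] [InnerProductSpace 𝕜 F]
variable [NormedAddCommGroup G] [InnerProductSpace 𝕜 G]
variable [NormedAddCommGroup E'] [InnerProductSpace 𝕜 E']
variable [NormedAddCommGroup F'] [InnerProductSpace 𝕜 F']
variable [NormedAddCommGroup G'] [InnerProductSpace 𝕜 G']

/-! ### §0 Plumbing: the zero operator's domain; eigenvalues of `T*T` and `SS*` are non-negative -/

/-- The zero operator is everywhere, hence densely, defined. [folklore] -/
private theorem dense_zero_pmap_domain {D : Type*} [NormedAddCommGroup D] [InnerProductSpace 𝕜 D] :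
    Dense (((0 : D →ₗ.[𝕜] D).domain : Submodule 𝕜 D) : Set D) := by
  rw [LinearPMap.zero_domain, Submodule.top_coe]; exact dense_univ

/-- `K (t/C)^{-α} = K C^α t^{-α}` for `t ≥ 0`, `C ≥ 0`. [folklore] -/
private theorem mul_div_rpow_neg_eq {K C α t : ℝ} (ht : 0 ≤ t) (hC : 0 ≤ C) :
    K * (t / C) ^ (-α) = K * C ^ α * t ^ (-α) := by
  rw [Real.div_rpow ht hC, Real.rpow_neg hC, div_inv_eq_mul]
  ring

section NonnegEnds

variable [CompleteSpace E] [CompleteSpace F] [CompleteSpace G]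
variable {T : E →ₗ.[𝕜] F} {S : F →ₗ.[𝕜] G} {A : E →ₗ.[𝕜] E} {C : G →ₗ.[𝕜] G}

omit [CompleteSpace F] in
/-- **Eigenvalues of `T*T` are non-negative**: `T*Te = me`, `e ≠ 0`, `m ∈ ℝ` ⇒ `0 ≤ m` (`m‖e‖² = (T*Te, e) = ‖Te‖²`;
here through the bridge presenting `T*T` as the Laplacian `00* + T*T` of the window `E →0 E →T F` and
`eigenvalue_nonneg`). [cite: Kato1966, V §3.7 Thm 3.24 (`T*T ≥ 0`); BruningLesch1992, §2 (2.14a) (`Δ_ev = D*D`)] -/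
theorem eigenvalue_adjointCompSelf_nonneg (hdT : Dense (T.domain : Set E))
    (hdomA : ∀ x : E, x ∈ A.domain ↔ ∃ hx : x ∈ T.domain, T ⟨x, hx⟩ ∈ T†.domain)
    (hvalA : ∀ (x : A.domain) (hx : (x : E) ∈ T.domain) (hTx : T ⟨x, hx⟩ ∈ T†.domain),
      A x = T† ⟨T ⟨x, hx⟩, hTx⟩)
    {e : E} (he0 : e ≠ 0) {m : ℝ} (he : ∃ h : e ∈ A.domain, A ⟨e, h⟩ = ((m : ℝ) : 𝕜) • e) : 0 ≤ m :=
  eigenvalue_nonneg (T := (0 : E →ₗ.[𝕜] E)) (S := T) dense_zero_pmap_domain hdT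
    (laplacian_domain_iff_of_adjointCompSelf hdomA) (laplacian_apply_of_adjointCompSelf hvalA) he0 he

/-- **Eigenvalues of `SS*` are non-negative**: `SS*e = me`, `e ≠ 0` ⇒ `0 ≤ m` (`m‖e‖² = ‖S*e‖²`; through the bridge
presenting `SS*` as the Laplacian `SS* + 0*0` of the window `F →S G →0 G`). [cite: Kato1966, V §3.7 Thm 3.24 (applied to
the closed operator `S*`, `(S*)*S* = SS*`); BruningLesch1992, §2 (2.14a) (`Δ_odd = DD*`)] -/
theorem eigenvalue_selfCompAdjoint_nonneg (hdS : Dense (S.domain : Set F))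
    (hdomC : ∀ y : G, y ∈ C.domain ↔ ∃ hy : y ∈ S†.domain, S† ⟨y, hy⟩ ∈ S.domain)
    (hvalC : ∀ (y : C.domain) (hy : (y : G) ∈ S†.domain) (hSy : S† ⟨y, hy⟩ ∈ S.domain),
      C y = S ⟨S† ⟨y, hy⟩, hSy⟩)
    {e : G} (he0 : e ≠ 0) {m : ℝ} (he : ∃ h : e ∈ C.domain, C ⟨e, h⟩ = ((m : ℝ) : 𝕜) • e) : 0 ≤ m :=
  eigenvalue_nonneg (T := S) (S := (0 : G →ₗ.[𝕜] G)) hdS dense_zero_pmap_domain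
    (laplacian_domain_iff_of_selfCompAdjoint hdomC) (laplacian_apply_of_selfCompAdjoint hvalC) he0 he

end NonnegEnds

/-! ### §1 Corollary 2.18 for `Δ₀ = T*T` -/

section DegreeZero

variable [CompleteSpace E] [CompleteSpace E']
variable {T : E →ₗ.[𝕜] F} {A : E →ₗ.[𝕜] E} {ι : Type*} {b : HilbertBasis ι 𝕜 E} {μ : ι → ℝ}
variable {T' : E' →ₗ.[𝕜] F'} {A' : E' →ₗ.[𝕜] E'} {ι' : Type*} {b' : HilbertBasis ι' 𝕜 E'} {μ' : ι' → ℝ}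
variable {g_E : E →L[𝕜] E'} {g_F : F →L[𝕜] F'} {k_E : E' →L[𝕜] E} {k_F : F' →L[𝕜] F}

/-- **Heat-trace domination in degree `0`**: for an isomorphism of discrete complexes `(g_E, g_F) ⇄ (k_E, k_F)` with
`‖g‖ ≤ M_g`, `‖k‖ ≤ M_k`, and `C = max((M_g M_k)², 1)`: if `∑ᵢ e^{-(t/C)μᵢ}` converges (`t ≥ 0`, `μ` the eigenvalues of
`T*T`), then `∑ⱼ e^{-tμ′ⱼ}` converges (`μ′` the eigenvalues of `T′*T′`) and `tr e^{-tT′*T′} ≤ tr e^{-(t/C)T*T}`. This is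
(2.52) `λ′ₙ ≥ C⁻¹λₙ` summed against `e^{-t·}`. [cite: BruningLesch1992, §2 Cor 2.18 (via Lemma 2.17 (2.52))] -/
theorem summable_and_tsum_exp_neg_mul_adjointCompSelf_le_of_iso (hdT : Dense (T.domain : Set E))
    (hdomA : ∀ x : E, x ∈ A.domain ↔ ∃ hx : x ∈ T.domain, T ⟨x, hx⟩ ∈ T†.domain)
    (hvalA : ∀ (x : A.domain) (hx : (x : E) ∈ T.domain) (hTx : T ⟨x, hx⟩ ∈ T†.domain),
      A x = T† ⟨T ⟨x, hx⟩, hTx⟩)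
    (heig : ∀ i, ∃ h : (b i : E) ∈ A.domain, A ⟨b i, h⟩ = ((μ i : ℝ) : 𝕜) • (b i : E))
    (htend : Tendsto μ cofinite atTop)
    (hdT' : Dense (T'.domain : Set E'))
    (hdomA' : ∀ x : E', x ∈ A'.domain ↔ ∃ hx : x ∈ T'.domain, T' ⟨x, hx⟩ ∈ T'†.domain)
    (hvalA' : ∀ (x : A'.domain) (hx : (x : E') ∈ T'.domain) (hTx : T' ⟨x, hx⟩ ∈ T'†.domain),
      A' x = T'† ⟨T' ⟨x, hx⟩, hTx⟩)
    (heig' : ∀ j, ∃ h : (b' j : E') ∈ A'.domain, A' ⟨b' j, h⟩ = ((μ' j : ℝ) : 𝕜) • (b' j : E'))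
    (htend' : Tendsto μ' cofinite atTop)
    (hgT : ∀ (w : E) (hw : w ∈ T.domain), ∃ h : g_E w ∈ T'.domain, T' ⟨g_E w, h⟩ = g_F (T ⟨w, hw⟩))
    (hkT : ∀ (w' : E') (hw' : w' ∈ T'.domain), ∃ h : k_E w' ∈ T.domain, T ⟨k_E w', h⟩ = k_F (T' ⟨w', hw'⟩))
    (hkg_E : ∀ w : E, k_E (g_E w) = w) (hgk_E : ∀ w' : E', g_E (k_E w') = w')
    {Mg Mk : ℝ} (hMg : 0 < Mg) (hMk : 0 < Mk) (hgE : ∀ w : E, ‖g_E w‖ ≤ Mg * ‖w‖)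
    (hgF : ∀ y : F, ‖g_F y‖ ≤ Mg * ‖y‖) (hkE : ∀ w' : E', ‖k_E w'‖ ≤ Mk * ‖w'‖)
    (hkF : ∀ y' : F', ‖k_F y'‖ ≤ Mk * ‖y'‖) {t : ℝ} (ht : 0 ≤ t)
    (hs : Summable fun i ↦ Real.exp (-(t / max ((Mg * Mk) ^ 2) 1 * μ i))) :
    Summable (fun j ↦ Real.exp (-(t * μ' j))) ∧
      ∑' j, Real.exp (-(t * μ' j)) ≤ ∑' i, Real.exp (-(t / max ((Mg * Mk) ^ 2) 1 * μ i)) := by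
  have hμ0 : ∀ i, 0 ≤ μ i := fun i ↦
    eigenvalue_adjointCompSelf_nonneg hdT hdomA hvalA (b.orthonormal.ne_zero i) (heig i)
  have hcmp : ∀ l : ℝ, {j | μ' j < l}.ncard ≤ {i | μ i < max ((Mg * Mk) ^ 2) 1 * l}.ncard :=
    ncard_setOf_lt_le_of_le_of_forall_ncard_setOf_lt_le htend hμ0 (sq_nonneg _) (le_max_left _ _) fun l ↦
      (ncard_eigenvalue_adjointCompSelf_lt_le_of_iso hdT hdomA hvalA heig htend hdT' hdomA' hvalA' heig' htend' hgT
        hkT hkg_E hgk_E hMg hMk hgE hgF hkE hkF l).2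
  exact summable_and_tsum_exp_neg_mul_le_of_forall_ncard_setOf_lt_le htend htend'
    (lt_of_lt_of_le one_pos (le_max_right _ _)) hcmp ht hs

/-- **COROLLARY 2.18 in degree `0` (`Δ₀ = T*T`).** If `tr e^{-tT*T} = ∑ᵢ e^{-tμᵢ}` converges with
`tr e^{-tT*T} ≤ K t^{-α}` for `0 < t ≤ t₀`, then for every isomorphic discrete complex (`‖g‖ ≤ M_g`, `‖k‖ ≤ M_k`,
`C = max((M_g M_k)², 1)`) also `tr e^{-tT′*T′}` converges and `tr e^{-tT′*T′} ≤ K C^α t^{-α}` for `0 < t ≤ t₀`: "we have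
also `tr e^{-tΔ′} ≤ C′t^{-α}`, `0 < t ≤ 1`" with `C′ = K C^α` (BL92 print `t₀ = 1`). [cite: BruningLesch1992, §2 Cor 2.18] -/
theorem tsum_exp_neg_mul_adjointCompSelf_le_mul_rpow_neg_of_iso (hdT : Dense (T.domain : Set E))
    (hdomA : ∀ x : E, x ∈ A.domain ↔ ∃ hx : x ∈ T.domain, T ⟨x, hx⟩ ∈ T†.domain)
    (hvalA : ∀ (x : A.domain) (hx : (x : E) ∈ T.domain) (hTx : T ⟨x, hx⟩ ∈ T†.domain),
      A x = T† ⟨T ⟨x, hx⟩, hTx⟩)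
    (heig : ∀ i, ∃ h : (b i : E) ∈ A.domain, A ⟨b i, h⟩ = ((μ i : ℝ) : 𝕜) • (b i : E))
    (htend : Tendsto μ cofinite atTop)
    (hdT' : Dense (T'.domain : Set E'))
    (hdomA' : ∀ x : E', x ∈ A'.domain ↔ ∃ hx : x ∈ T'.domain, T' ⟨x, hx⟩ ∈ T'†.domain)
    (hvalA' : ∀ (x : A'.domain) (hx : (x : E') ∈ T'.domain) (hTx : T' ⟨x, hx⟩ ∈ T'†.domain),
      A' x = T'† ⟨T' ⟨x, hx⟩, hTx⟩)
    (heig' : ∀ j, ∃ h : (b' j : E') ∈ A'.domain, A' ⟨b' j, h⟩ = ((μ' j : ℝ) : 𝕜) • (b' j : E'))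
    (htend' : Tendsto μ' cofinite atTop)
    (hgT : ∀ (w : E) (hw : w ∈ T.domain), ∃ h : g_E w ∈ T'.domain, T' ⟨g_E w, h⟩ = g_F (T ⟨w, hw⟩))
    (hkT : ∀ (w' : E') (hw' : w' ∈ T'.domain), ∃ h : k_E w' ∈ T.domain, T ⟨k_E w', h⟩ = k_F (T' ⟨w', hw'⟩))
    (hkg_E : ∀ w : E, k_E (g_E w) = w) (hgk_E : ∀ w' : E', g_E (k_E w') = w')
    {Mg Mk : ℝ} (hMg : 0 < Mg) (hMk : 0 < Mk) (hgE : ∀ w : E, ‖g_E w‖ ≤ Mg * ‖w‖)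
    (hgF : ∀ y : F, ‖g_F y‖ ≤ Mg * ‖y‖) (hkE : ∀ w' : E', ‖k_E w'‖ ≤ Mk * ‖w'‖)
    (hkF : ∀ y' : F', ‖k_F y'‖ ≤ Mk * ‖y'‖) {K α t₀ : ℝ}
    (hK : ∀ t : ℝ, 0 < t → t ≤ t₀ →
      Summable (fun i ↦ Real.exp (-(t * μ i))) ∧ ∑' i, Real.exp (-(t * μ i)) ≤ K * t ^ (-α))
    {t : ℝ} (ht : 0 < t) (ht₀ : t ≤ t₀) :
    Summable (fun j ↦ Real.exp (-(t * μ' j))) ∧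
      ∑' j, Real.exp (-(t * μ' j)) ≤ K * (max ((Mg * Mk) ^ 2) 1) ^ α * t ^ (-α) := by
  have hμ0 : ∀ i, 0 ≤ μ i := fun i ↦
    eigenvalue_adjointCompSelf_nonneg hdT hdomA hvalA (b.orthonormal.ne_zero i) (heig i)
  have hcmp : ∀ l : ℝ, {j | μ' j < l}.ncard ≤ {i | μ i < max ((Mg * Mk) ^ 2) 1 * l}.ncard :=
    ncard_setOf_lt_le_of_le_of_forall_ncard_setOf_lt_le htend hμ0 (sq_nonneg _) (le_max_left _ _) fun l ↦
      (ncard_eigenvalue_adjointCompSelf_lt_le_of_iso hdT hdomA hvalA heig htend hdT' hdomA' hvalA' heig' htend' hgT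
        hkT hkg_E hgk_E hMg hMk hgE hgF hkE hkF l).2
  exact tsum_exp_neg_mul_le_mul_rpow_neg_of_forall_ncard_setOf_lt_le htend htend' (le_max_right _ _) hcmp hK ht ht₀

end DegreeZero

/-! ### §2 Corollary 2.18 for `Δ₂ = SS*` -/

section DegreeTwo

variable [CompleteSpace F] [CompleteSpace G] [CompleteSpace F'] [CompleteSpace G']
variable {S : F →ₗ.[𝕜] G} {C : G →ₗ.[𝕜] G} {ι : Type*} {b : HilbertBasis ι 𝕜 G} {μ : ι → ℝ}
variable {S' : F' →ₗ.[𝕜] G'} {C' : G' →ₗ.[𝕜] G'} {ι' : Type*} {b' : HilbertBasis ι' 𝕜 G'} {μ' : ι' → ℝ}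
variable {g_F : F →L[𝕜] F'} {g_G : G →L[𝕜] G'} {k_F : F' →L[𝕜] F} {k_G : G' →L[𝕜] G}

/-- **Heat-trace domination in degree `2`**: for an isomorphism `(g_F, g_G) ⇄ (k_F, k_G)` of discrete complexes with
`‖g‖ ≤ M_g`, `‖k‖ ≤ M_k`, `C = max((M_g M_k)², 1)`: if `∑ᵢ e^{-(t/C)μᵢ}` converges (`μ` the eigenvalues of `SS*`,
`t ≥ 0`) then `∑ⱼ e^{-tμ′ⱼ}` converges (`μ′` those of `S′S′*`) and `tr e^{-tS′S′*} ≤ tr e^{-(t/C)SS*}`.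
[cite: BruningLesch1992, §2 Cor 2.18 (via Lemma 2.17 (2.52))] -/
theorem summable_and_tsum_exp_neg_mul_selfCompAdjoint_le_of_iso (hdS : Dense (S.domain : Set F))
    (hdomC : ∀ y : G, y ∈ C.domain ↔ ∃ hy : y ∈ S†.domain, S† ⟨y, hy⟩ ∈ S.domain)
    (hvalC : ∀ (y : C.domain) (hy : (y : G) ∈ S†.domain) (hSy : S† ⟨y, hy⟩ ∈ S.domain),
      C y = S ⟨S† ⟨y, hy⟩, hSy⟩)
    (heig : ∀ i, ∃ h : (b i : G) ∈ C.domain, C ⟨b i, h⟩ = ((μ i : ℝ) : 𝕜) • (b i : G))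
    (htend : Tendsto μ cofinite atTop)
    (hdS' : Dense (S'.domain : Set F'))
    (hdomC' : ∀ y : G', y ∈ C'.domain ↔ ∃ hy : y ∈ S'†.domain, S'† ⟨y, hy⟩ ∈ S'.domain)
    (hvalC' : ∀ (y : C'.domain) (hy : (y : G') ∈ S'†.domain) (hSy : S'† ⟨y, hy⟩ ∈ S'.domain),
      C' y = S' ⟨S'† ⟨y, hy⟩, hSy⟩)
    (heig' : ∀ j, ∃ h : (b' j : G') ∈ C'.domain, C' ⟨b' j, h⟩ = ((μ' j : ℝ) : 𝕜) • (b' j : G'))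
    (htend' : Tendsto μ' cofinite atTop)
    (hgS : ∀ (u : F) (hu : u ∈ S.domain), ∃ h : g_F u ∈ S'.domain, S' ⟨g_F u, h⟩ = g_G (S ⟨u, hu⟩))
    (hkS : ∀ (u' : F') (hu' : u' ∈ S'.domain), ∃ h : k_F u' ∈ S.domain, S ⟨k_F u', h⟩ = k_G (S' ⟨u', hu'⟩))
    (hkg_G : ∀ z : G, k_G (g_G z) = z) (hgk_G : ∀ z' : G', g_G (k_G z') = z')
    {Mg Mk : ℝ} (hMg : 0 < Mg) (hMk : 0 < Mk) (hgF : ∀ y : F, ‖g_F y‖ ≤ Mg * ‖y‖)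
    (hgG : ∀ z : G, ‖g_G z‖ ≤ Mg * ‖z‖) (hkF : ∀ y' : F', ‖k_F y'‖ ≤ Mk * ‖y'‖)
    (hkG : ∀ z' : G', ‖k_G z'‖ ≤ Mk * ‖z'‖) {t : ℝ} (ht : 0 ≤ t)
    (hs : Summable fun i ↦ Real.exp (-(t / max ((Mg * Mk) ^ 2) 1 * μ i))) :
    Summable (fun j ↦ Real.exp (-(t * μ' j))) ∧
      ∑' j, Real.exp (-(t * μ' j)) ≤ ∑' i, Real.exp (-(t / max ((Mg * Mk) ^ 2) 1 * μ i)) := by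
  have hμ0 : ∀ i, 0 ≤ μ i := fun i ↦
    eigenvalue_selfCompAdjoint_nonneg hdS hdomC hvalC (b.orthonormal.ne_zero i) (heig i)
  have hcmp : ∀ l : ℝ, {j | μ' j < l}.ncard ≤ {i | μ i < max ((Mg * Mk) ^ 2) 1 * l}.ncard :=
    ncard_setOf_lt_le_of_le_of_forall_ncard_setOf_lt_le htend hμ0 (sq_nonneg _) (le_max_left _ _) fun l ↦
      (ncard_eigenvalue_selfCompAdjoint_lt_le_of_iso hdS hdomC hvalC heig htend hdS' hdomC' hvalC' heig' htend' hgS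
        hkS hkg_G hgk_G hMg hMk hgF hgG hkF hkG l).2
  exact summable_and_tsum_exp_neg_mul_le_of_forall_ncard_setOf_lt_le htend htend'
    (lt_of_lt_of_le one_pos (le_max_right _ _)) hcmp ht hs

/-- **COROLLARY 2.18 in degree `2` (`Δ₂ = SS*`).** `tr e^{-tSS*} ≤ K t^{-α}` on `(0, t₀]` (with convergence) implies, for
an isomorphic discrete complex, `tr e^{-tS′S′*} ≤ K C^α t^{-α}` on `(0, t₀]` (with convergence), `C = max((M_g M_k)², 1)`.
[cite: BruningLesch1992, §2 Cor 2.18] -/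
theorem tsum_exp_neg_mul_selfCompAdjoint_le_mul_rpow_neg_of_iso (hdS : Dense (S.domain : Set F))
    (hdomC : ∀ y : G, y ∈ C.domain ↔ ∃ hy : y ∈ S†.domain, S† ⟨y, hy⟩ ∈ S.domain)
    (hvalC : ∀ (y : C.domain) (hy : (y : G) ∈ S†.domain) (hSy : S† ⟨y, hy⟩ ∈ S.domain),
      C y = S ⟨S† ⟨y, hy⟩, hSy⟩)
    (heig : ∀ i, ∃ h : (b i : G) ∈ C.domain, C ⟨b i, h⟩ = ((μ i : ℝ) : 𝕜) • (b i : G))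
    (htend : Tendsto μ cofinite atTop)
    (hdS' : Dense (S'.domain : Set F'))
    (hdomC' : ∀ y : G', y ∈ C'.domain ↔ ∃ hy : y ∈ S'†.domain, S'† ⟨y, hy⟩ ∈ S'.domain)
    (hvalC' : ∀ (y : C'.domain) (hy : (y : G') ∈ S'†.domain) (hSy : S'† ⟨y, hy⟩ ∈ S'.domain),
      C' y = S' ⟨S'† ⟨y, hy⟩, hSy⟩)
    (heig' : ∀ j, ∃ h : (b' j : G') ∈ C'.domain, C' ⟨b' j, h⟩ = ((μ' j : ℝ) : 𝕜) • (b' j : G'))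
    (htend' : Tendsto μ' cofinite atTop)
    (hgS : ∀ (u : F) (hu : u ∈ S.domain), ∃ h : g_F u ∈ S'.domain, S' ⟨g_F u, h⟩ = g_G (S ⟨u, hu⟩))
    (hkS : ∀ (u' : F') (hu' : u' ∈ S'.domain), ∃ h : k_F u' ∈ S.domain, S ⟨k_F u', h⟩ = k_G (S' ⟨u', hu'⟩))
    (hkg_G : ∀ z : G, k_G (g_G z) = z) (hgk_G : ∀ z' : G', g_G (k_G z') = z')
    {Mg Mk : ℝ} (hMg : 0 < Mg) (hMk : 0 < Mk) (hgF : ∀ y : F, ‖g_F y‖ ≤ Mg * ‖y‖)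
    (hgG : ∀ z : G, ‖g_G z‖ ≤ Mg * ‖z‖) (hkF : ∀ y' : F', ‖k_F y'‖ ≤ Mk * ‖y'‖)
    (hkG : ∀ z' : G', ‖k_G z'‖ ≤ Mk * ‖z'‖) {K α t₀ : ℝ}
    (hK : ∀ t : ℝ, 0 < t → t ≤ t₀ →
      Summable (fun i ↦ Real.exp (-(t * μ i))) ∧ ∑' i, Real.exp (-(t * μ i)) ≤ K * t ^ (-α))
    {t : ℝ} (ht : 0 < t) (ht₀ : t ≤ t₀) :
    Summable (fun j ↦ Real.exp (-(t * μ' j))) ∧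
      ∑' j, Real.exp (-(t * μ' j)) ≤ K * (max ((Mg * Mk) ^ 2) 1) ^ α * t ^ (-α) := by
  have hμ0 : ∀ i, 0 ≤ μ i := fun i ↦
    eigenvalue_selfCompAdjoint_nonneg hdS hdomC hvalC (b.orthonormal.ne_zero i) (heig i)
  have hcmp : ∀ l : ℝ, {j | μ' j < l}.ncard ≤ {i | μ i < max ((Mg * Mk) ^ 2) 1 * l}.ncard :=
    ncard_setOf_lt_le_of_le_of_forall_ncard_setOf_lt_le htend hμ0 (sq_nonneg _) (le_max_left _ _) fun l ↦
      (ncard_eigenvalue_selfCompAdjoint_lt_le_of_iso hdS hdomC hvalC heig htend hdS' hdomC' hvalC' heig' htend' hgS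
        hkS hkg_G hgk_G hMg hMk hgF hgG hkF hkG l).2
  exact tsum_exp_neg_mul_le_mul_rpow_neg_of_forall_ncard_setOf_lt_le htend htend' (le_max_right _ _) hcmp hK ht ht₀

end DegreeTwo

/-! ### §3 Corollary 2.18 for the middle Laplacian `Δ₁ = □ = TT* + S*S`, and §4 for `Δ = Δ₀ ⊕ Δ₁ ⊕ Δ₂` -/

section Middle

variable [CompleteSpace E] [CompleteSpace F] [CompleteSpace G] [CompleteSpace E'] [CompleteSpace F']
  [CompleteSpace G']
variable {T : E →ₗ.[𝕜] F} {S : F →ₗ.[𝕜] G} {A : E →ₗ.[𝕜] E} {L : F →ₗ.[𝕜] F} {C : G →ₗ.[𝕜] G}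
variable {ι_E ι_F ι_G : Type*} {b_E : HilbertBasis ι_E 𝕜 E} {b_F : HilbertBasis ι_F 𝕜 F} {b_G : HilbertBasis ι_G 𝕜 G}
  {μ_E : ι_E → ℝ} {μ_F : ι_F → ℝ} {μ_G : ι_G → ℝ}
variable {T' : E' →ₗ.[𝕜] F'} {S' : F' →ₗ.[𝕜] G'} {A' : E' →ₗ.[𝕜] E'} {L' : F' →ₗ.[𝕜] F'} {C' : G' →ₗ.[𝕜] G'}
variable {ι'_E ι'_F ι'_G : Type*} {b'_E : HilbertBasis ι'_E 𝕜 E'} {b'_F : HilbertBasis ι'_F 𝕜 F'}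
  {b'_G : HilbertBasis ι'_G 𝕜 G'} {μ'_E : ι'_E → ℝ} {μ'_F : ι'_F → ℝ} {μ'_G : ι'_G → ℝ}
variable {g_E : E →L[𝕜] E'} {g_F : F →L[𝕜] F'} {g_G : G →L[𝕜] G'}
  {k_E : E' →L[𝕜] E} {k_F : F' →L[𝕜] F} {k_G : G' →L[𝕜] G}

/-- **Heat-trace domination in the middle degree**: for an isomorphism `(g_E, g_F, g_G) ⇄ (k_E, k_F, k_G)` of
discrete short complexes (all three Laplacians on each side with eigenbases) with `‖g‖ ≤ M_g`, `‖k‖ ≤ M_k`,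
`C = max((M_g M_k)², 1)`: if `∑ⱼ e^{-(t/C)μ_F j}` converges (`t ≥ 0`) then `∑ⱼ e^{-tμ′_F j}` converges and
`tr e^{-t□′} ≤ tr e^{-(t/C)□}`. [cite: BruningLesch1992, §2 Cor 2.18 (via Lemma 2.17 (2.52))] -/
theorem summable_and_tsum_exp_neg_mul_laplacian_le_of_iso (hdT : Dense (T.domain : Set E))
    (hdS : Dense (S.domain : Set F)) (hcS : S.IsClosed)
    (hST : LinearMap.range T.toFun ≤ (LinearMap.ker S.toFun).map S.domain.subtype)
    (hdomA : ∀ x : E, x ∈ A.domain ↔ ∃ hx : x ∈ T.domain, T ⟨x, hx⟩ ∈ T†.domain)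
    (hvalA : ∀ (x : A.domain) (hx : (x : E) ∈ T.domain) (hTx : T ⟨x, hx⟩ ∈ T†.domain),
      A x = T† ⟨T ⟨x, hx⟩, hTx⟩)
    (hdom : ∀ x : F, x ∈ L.domain ↔ (∃ hxT : x ∈ T†.domain, T† ⟨x, hxT⟩ ∈ T.domain) ∧
      (∃ hxS : x ∈ S.domain, S ⟨x, hxS⟩ ∈ S†.domain))
    (hval : ∀ (x : L.domain) (hxT : (x : F) ∈ T†.domain) (hTx : T† ⟨x, hxT⟩ ∈ T.domain)
      (hxS : (x : F) ∈ S.domain) (hSx : S ⟨x, hxS⟩ ∈ S†.domain),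
      L x = T ⟨T† ⟨x, hxT⟩, hTx⟩ + S† ⟨S ⟨x, hxS⟩, hSx⟩)
    (hdomC : ∀ y : G, y ∈ C.domain ↔ ∃ hy : y ∈ S†.domain, S† ⟨y, hy⟩ ∈ S.domain)
    (hvalC : ∀ (y : C.domain) (hy : (y : G) ∈ S†.domain) (hSy : S† ⟨y, hy⟩ ∈ S.domain),
      C y = S ⟨S† ⟨y, hy⟩, hSy⟩)
    (heig_E : ∀ i, ∃ h : (b_E i : E) ∈ A.domain, A ⟨b_E i, h⟩ = ((μ_E i : ℝ) : 𝕜) • (b_E i : E))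
    (heig_F : ∀ j, ∃ h : (b_F j : F) ∈ L.domain, L ⟨b_F j, h⟩ = ((μ_F j : ℝ) : 𝕜) • (b_F j : F))
    (heig_G : ∀ k, ∃ h : (b_G k : G) ∈ C.domain, C ⟨b_G k, h⟩ = ((μ_G k : ℝ) : 𝕜) • (b_G k : G))
    (htend_E : Tendsto μ_E cofinite atTop) (htend_F : Tendsto μ_F cofinite atTop)
    (htend_G : Tendsto μ_G cofinite atTop)
    (hdT' : Dense (T'.domain : Set E')) (hdS' : Dense (S'.domain : Set F')) (hcS' : S'.IsClosed)
    (hST' : LinearMap.range T'.toFun ≤ (LinearMap.ker S'.toFun).map S'.domain.subtype)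
    (hdomA' : ∀ x : E', x ∈ A'.domain ↔ ∃ hx : x ∈ T'.domain, T' ⟨x, hx⟩ ∈ T'†.domain)
    (hvalA' : ∀ (x : A'.domain) (hx : (x : E') ∈ T'.domain) (hTx : T' ⟨x, hx⟩ ∈ T'†.domain),
      A' x = T'† ⟨T' ⟨x, hx⟩, hTx⟩)
    (hdom' : ∀ x : F', x ∈ L'.domain ↔ (∃ hxT : x ∈ T'†.domain, T'† ⟨x, hxT⟩ ∈ T'.domain) ∧
      (∃ hxS : x ∈ S'.domain, S' ⟨x, hxS⟩ ∈ S'†.domain))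
    (hval' : ∀ (x : L'.domain) (hxT : (x : F') ∈ T'†.domain) (hTx : T'† ⟨x, hxT⟩ ∈ T'.domain)
      (hxS : (x : F') ∈ S'.domain) (hSx : S' ⟨x, hxS⟩ ∈ S'†.domain),
      L' x = T' ⟨T'† ⟨x, hxT⟩, hTx⟩ + S'† ⟨S' ⟨x, hxS⟩, hSx⟩)
    (hdomC' : ∀ y : G', y ∈ C'.domain ↔ ∃ hy : y ∈ S'†.domain, S'† ⟨y, hy⟩ ∈ S'.domain)
    (hvalC' : ∀ (y : C'.domain) (hy : (y : G') ∈ S'†.domain) (hSy : S'† ⟨y, hy⟩ ∈ S'.domain),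
      C' y = S' ⟨S'† ⟨y, hy⟩, hSy⟩)
    (heig'_E : ∀ i, ∃ h : (b'_E i : E') ∈ A'.domain, A' ⟨b'_E i, h⟩ = ((μ'_E i : ℝ) : 𝕜) • (b'_E i : E'))
    (heig'_F : ∀ j, ∃ h : (b'_F j : F') ∈ L'.domain, L' ⟨b'_F j, h⟩ = ((μ'_F j : ℝ) : 𝕜) • (b'_F j : F'))
    (heig'_G : ∀ k, ∃ h : (b'_G k : G') ∈ C'.domain, C' ⟨b'_G k, h⟩ = ((μ'_G k : ℝ) : 𝕜) • (b'_G k : G'))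
    (htend'_E : Tendsto μ'_E cofinite atTop) (htend'_F : Tendsto μ'_F cofinite atTop)
    (htend'_G : Tendsto μ'_G cofinite atTop)
    (hgT : ∀ (w : E) (hw : w ∈ T.domain), ∃ h : g_E w ∈ T'.domain, T' ⟨g_E w, h⟩ = g_F (T ⟨w, hw⟩))
    (hgS : ∀ (u : F) (hu : u ∈ S.domain), ∃ h : g_F u ∈ S'.domain, S' ⟨g_F u, h⟩ = g_G (S ⟨u, hu⟩))
    (hkT : ∀ (w' : E') (hw' : w' ∈ T'.domain), ∃ h : k_E w' ∈ T.domain, T ⟨k_E w', h⟩ = k_F (T' ⟨w', hw'⟩))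
    (hkS : ∀ (u' : F') (hu' : u' ∈ S'.domain), ∃ h : k_F u' ∈ S.domain, S ⟨k_F u', h⟩ = k_G (S' ⟨u', hu'⟩))
    (hkg_E : ∀ w : E, k_E (g_E w) = w) (hgk_E : ∀ w' : E', g_E (k_E w') = w')
    (hkg_F : ∀ u : F, k_F (g_F u) = u) (hgk_F : ∀ u' : F', g_F (k_F u') = u')
    (hkg_G : ∀ z : G, k_G (g_G z) = z) (hgk_G : ∀ z' : G', g_G (k_G z') = z')
    {Mg Mk : ℝ} (hMg : 0 < Mg) (hMk : 0 < Mk) (hgE : ∀ w : E, ‖g_E w‖ ≤ Mg * ‖w‖)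
    (hgF : ∀ y : F, ‖g_F y‖ ≤ Mg * ‖y‖) (hgG : ∀ z : G, ‖g_G z‖ ≤ Mg * ‖z‖)
    (hkE : ∀ w' : E', ‖k_E w'‖ ≤ Mk * ‖w'‖) (hkF : ∀ y' : F', ‖k_F y'‖ ≤ Mk * ‖y'‖)
    (hkG : ∀ z' : G', ‖k_G z'‖ ≤ Mk * ‖z'‖) {t : ℝ} (ht : 0 ≤ t)
    (hs : Summable fun j ↦ Real.exp (-(t / max ((Mg * Mk) ^ 2) 1 * μ_F j))) :
    Summable (fun j ↦ Real.exp (-(t * μ'_F j))) ∧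
      ∑' j, Real.exp (-(t * μ'_F j)) ≤ ∑' j, Real.exp (-(t / max ((Mg * Mk) ^ 2) 1 * μ_F j)) := by
  have hμ0 : ∀ j, 0 ≤ μ_F j := fun j ↦ eigenvalue_nonneg hdT hdS hdom hval (b_F.orthonormal.ne_zero j) (heig_F j)
  have hcmp : ∀ l : ℝ, {j | μ'_F j < l}.ncard ≤ {j | μ_F j < max ((Mg * Mk) ^ 2) 1 * l}.ncard :=
    ncard_setOf_lt_le_of_le_of_forall_ncard_setOf_lt_le htend_F hμ0 (sq_nonneg _) (le_max_left _ _) fun l ↦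
      (ncard_eigenvalue_laplacian_comparison_of_iso hdT hdS hcS hST hdomA hvalA hdom hval hdomC hvalC heig_E heig_F
        heig_G htend_E htend_F htend_G hdT' hdS' hcS' hST' hdomA' hvalA' hdom' hval' hdomC' hvalC' heig'_E heig'_F
        heig'_G htend'_E htend'_F htend'_G hgT hgS hkT hkS hkg_E hgk_E hkg_F hgk_F hkg_G hgk_G hMg hMk hgE hgF hgG
        hkE hkF hkG l).2
  exact summable_and_tsum_exp_neg_mul_le_of_forall_ncard_setOf_lt_le htend_F htend'_F
    (lt_of_lt_of_le one_pos (le_max_right _ _)) hcmp ht hs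

/-- **COROLLARY 2.18 in the middle degree (`Δ₁ = □ = TT* + S*S`).** `tr e^{-t□} ≤ K t^{-α}` on `(0, t₀]` (with
convergence) implies, for an isomorphic discrete short complex, `tr e^{-t□′} ≤ K C^α t^{-α}` on `(0, t₀]` (with
convergence), `C = max((M_g M_k)², 1)`. [cite: BruningLesch1992, §2 Cor 2.18] -/
theorem tsum_exp_neg_mul_laplacian_le_mul_rpow_neg_of_iso (hdT : Dense (T.domain : Set E))
    (hdS : Dense (S.domain : Set F)) (hcS : S.IsClosed)
    (hST : LinearMap.range T.toFun ≤ (LinearMap.ker S.toFun).map S.domain.subtype)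
    (hdomA : ∀ x : E, x ∈ A.domain ↔ ∃ hx : x ∈ T.domain, T ⟨x, hx⟩ ∈ T†.domain)
    (hvalA : ∀ (x : A.domain) (hx : (x : E) ∈ T.domain) (hTx : T ⟨x, hx⟩ ∈ T†.domain),
      A x = T† ⟨T ⟨x, hx⟩, hTx⟩)
    (hdom : ∀ x : F, x ∈ L.domain ↔ (∃ hxT : x ∈ T†.domain, T† ⟨x, hxT⟩ ∈ T.domain) ∧
      (∃ hxS : x ∈ S.domain, S ⟨x, hxS⟩ ∈ S†.domain))
    (hval : ∀ (x : L.domain) (hxT : (x : F) ∈ T†.domain) (hTx : T† ⟨x, hxT⟩ ∈ T.domain)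
      (hxS : (x : F) ∈ S.domain) (hSx : S ⟨x, hxS⟩ ∈ S†.domain),
      L x = T ⟨T† ⟨x, hxT⟩, hTx⟩ + S† ⟨S ⟨x, hxS⟩, hSx⟩)
    (hdomC : ∀ y : G, y ∈ C.domain ↔ ∃ hy : y ∈ S†.domain, S† ⟨y, hy⟩ ∈ S.domain)
    (hvalC : ∀ (y : C.domain) (hy : (y : G) ∈ S†.domain) (hSy : S† ⟨y, hy⟩ ∈ S.domain),
      C y = S ⟨S† ⟨y, hy⟩, hSy⟩)
    (heig_E : ∀ i, ∃ h : (b_E i : E) ∈ A.domain, A ⟨b_E i, h⟩ = ((μ_E i : ℝ) : 𝕜) • (b_E i : E))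
    (heig_F : ∀ j, ∃ h : (b_F j : F) ∈ L.domain, L ⟨b_F j, h⟩ = ((μ_F j : ℝ) : 𝕜) • (b_F j : F))
    (heig_G : ∀ k, ∃ h : (b_G k : G) ∈ C.domain, C ⟨b_G k, h⟩ = ((μ_G k : ℝ) : 𝕜) • (b_G k : G))
    (htend_E : Tendsto μ_E cofinite atTop) (htend_F : Tendsto μ_F cofinite atTop)
    (htend_G : Tendsto μ_G cofinite atTop)
    (hdT' : Dense (T'.domain : Set E')) (hdS' : Dense (S'.domain : Set F')) (hcS' : S'.IsClosed)
    (hST' : LinearMap.range T'.toFun ≤ (LinearMap.ker S'.toFun).map S'.domain.subtype)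
    (hdomA' : ∀ x : E', x ∈ A'.domain ↔ ∃ hx : x ∈ T'.domain, T' ⟨x, hx⟩ ∈ T'†.domain)
    (hvalA' : ∀ (x : A'.domain) (hx : (x : E') ∈ T'.domain) (hTx : T' ⟨x, hx⟩ ∈ T'†.domain),
      A' x = T'† ⟨T' ⟨x, hx⟩, hTx⟩)
    (hdom' : ∀ x : F', x ∈ L'.domain ↔ (∃ hxT : x ∈ T'†.domain, T'† ⟨x, hxT⟩ ∈ T'.domain) ∧
      (∃ hxS : x ∈ S'.domain, S' ⟨x, hxS⟩ ∈ S'†.domain))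
    (hval' : ∀ (x : L'.domain) (hxT : (x : F') ∈ T'†.domain) (hTx : T'† ⟨x, hxT⟩ ∈ T'.domain)
      (hxS : (x : F') ∈ S'.domain) (hSx : S' ⟨x, hxS⟩ ∈ S'†.domain),
      L' x = T' ⟨T'† ⟨x, hxT⟩, hTx⟩ + S'† ⟨S' ⟨x, hxS⟩, hSx⟩)
    (hdomC' : ∀ y : G', y ∈ C'.domain ↔ ∃ hy : y ∈ S'†.domain, S'† ⟨y, hy⟩ ∈ S'.domain)
    (hvalC' : ∀ (y : C'.domain) (hy : (y : G') ∈ S'†.domain) (hSy : S'† ⟨y, hy⟩ ∈ S'.domain),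
      C' y = S' ⟨S'† ⟨y, hy⟩, hSy⟩)
    (heig'_E : ∀ i, ∃ h : (b'_E i : E') ∈ A'.domain, A' ⟨b'_E i, h⟩ = ((μ'_E i : ℝ) : 𝕜) • (b'_E i : E'))
    (heig'_F : ∀ j, ∃ h : (b'_F j : F') ∈ L'.domain, L' ⟨b'_F j, h⟩ = ((μ'_F j : ℝ) : 𝕜) • (b'_F j : F'))
    (heig'_G : ∀ k, ∃ h : (b'_G k : G') ∈ C'.domain, C' ⟨b'_G k, h⟩ = ((μ'_G k : ℝ) : 𝕜) • (b'_G k : G'))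
    (htend'_E : Tendsto μ'_E cofinite atTop) (htend'_F : Tendsto μ'_F cofinite atTop)
    (htend'_G : Tendsto μ'_G cofinite atTop)
    (hgT : ∀ (w : E) (hw : w ∈ T.domain), ∃ h : g_E w ∈ T'.domain, T' ⟨g_E w, h⟩ = g_F (T ⟨w, hw⟩))
    (hgS : ∀ (u : F) (hu : u ∈ S.domain), ∃ h : g_F u ∈ S'.domain, S' ⟨g_F u, h⟩ = g_G (S ⟨u, hu⟩))
    (hkT : ∀ (w' : E') (hw' : w' ∈ T'.domain), ∃ h : k_E w' ∈ T.domain, T ⟨k_E w', h⟩ = k_F (T' ⟨w', hw'⟩))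
    (hkS : ∀ (u' : F') (hu' : u' ∈ S'.domain), ∃ h : k_F u' ∈ S.domain, S ⟨k_F u', h⟩ = k_G (S' ⟨u', hu'⟩))
    (hkg_E : ∀ w : E, k_E (g_E w) = w) (hgk_E : ∀ w' : E', g_E (k_E w') = w')
    (hkg_F : ∀ u : F, k_F (g_F u) = u) (hgk_F : ∀ u' : F', g_F (k_F u') = u')
    (hkg_G : ∀ z : G, k_G (g_G z) = z) (hgk_G : ∀ z' : G', g_G (k_G z') = z')
    {Mg Mk : ℝ} (hMg : 0 < Mg) (hMk : 0 < Mk) (hgE : ∀ w : E, ‖g_E w‖ ≤ Mg * ‖w‖)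
    (hgF : ∀ y : F, ‖g_F y‖ ≤ Mg * ‖y‖) (hgG : ∀ z : G, ‖g_G z‖ ≤ Mg * ‖z‖)
    (hkE : ∀ w' : E', ‖k_E w'‖ ≤ Mk * ‖w'‖) (hkF : ∀ y' : F', ‖k_F y'‖ ≤ Mk * ‖y'‖)
    (hkG : ∀ z' : G', ‖k_G z'‖ ≤ Mk * ‖z'‖) {K α t₀ : ℝ}
    (hK : ∀ t : ℝ, 0 < t → t ≤ t₀ →
      Summable (fun j ↦ Real.exp (-(t * μ_F j))) ∧ ∑' j, Real.exp (-(t * μ_F j)) ≤ K * t ^ (-α))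
    {t : ℝ} (ht : 0 < t) (ht₀ : t ≤ t₀) :
    Summable (fun j ↦ Real.exp (-(t * μ'_F j))) ∧
      ∑' j, Real.exp (-(t * μ'_F j)) ≤ K * (max ((Mg * Mk) ^ 2) 1) ^ α * t ^ (-α) := by
  have hμ0 : ∀ j, 0 ≤ μ_F j := fun j ↦ eigenvalue_nonneg hdT hdS hdom hval (b_F.orthonormal.ne_zero j) (heig_F j)
  have hcmp : ∀ l : ℝ, {j | μ'_F j < l}.ncard ≤ {j | μ_F j < max ((Mg * Mk) ^ 2) 1 * l}.ncard :=
    ncard_setOf_lt_le_of_le_of_forall_ncard_setOf_lt_le htend_F hμ0 (sq_nonneg _) (le_max_left _ _) fun l ↦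
      (ncard_eigenvalue_laplacian_comparison_of_iso hdT hdS hcS hST hdomA hvalA hdom hval hdomC hvalC heig_E heig_F
        heig_G htend_E htend_F htend_G hdT' hdS' hcS' hST' hdomA' hvalA' hdom' hval' hdomC' hvalC' heig'_E heig'_F
        heig'_G htend'_E htend'_F htend'_G hgT hgS hkT hkS hkg_E hgk_E hkg_F hgk_F hkg_G hgk_G hMg hMk hgE hgF hgG
        hkE hkF hkG l).2
  exact tsum_exp_neg_mul_le_mul_rpow_neg_of_forall_ncard_setOf_lt_le htend_F htend'_F (le_max_right _ _) hcmp hK ht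
    ht₀

/-! ### §4 `Δ = Δ₀ ⊕ Δ₁ ⊕ Δ₂`: the total heat trace `tr e^{-tΔ} = tr e^{-tT*T} + tr e^{-t□} + tr e^{-tSS*}` -/

/-- **Domination of the total heat trace** of a discrete short complex under an isomorphism: with
`C = max((M_g M_k)², 1)` and `t ≥ 0`, if the three series `∑ e^{-(t/C)μ_E}`, `∑ e^{-(t/C)μ_F}`, `∑ e^{-(t/C)μ_G}`
converge then the three primed series at time `t` converge and
`θ′_E(t) + θ′_F(t) + θ′_G(t) ≤ θ_E(t/C) + θ_F(t/C) + θ_G(t/C)`, i.e. `tr e^{-tΔ′} ≤ tr e^{-(t/C)Δ}` for `Δ = ⊕ᵢ Δᵢ`.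
[cite: BruningLesch1992, §2 Cor 2.18 (via Lemma 2.17 (2.52)), (2.9) (`Δ = ⊕ Δᵢ`)] -/
theorem heatTrace_complex_le_of_iso (hdT : Dense (T.domain : Set E))
    (hdS : Dense (S.domain : Set F)) (hcS : S.IsClosed)
    (hST : LinearMap.range T.toFun ≤ (LinearMap.ker S.toFun).map S.domain.subtype)
    (hdomA : ∀ x : E, x ∈ A.domain ↔ ∃ hx : x ∈ T.domain, T ⟨x, hx⟩ ∈ T†.domain)
    (hvalA : ∀ (x : A.domain) (hx : (x : E) ∈ T.domain) (hTx : T ⟨x, hx⟩ ∈ T†.domain),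
      A x = T† ⟨T ⟨x, hx⟩, hTx⟩)
    (hdom : ∀ x : F, x ∈ L.domain ↔ (∃ hxT : x ∈ T†.domain, T† ⟨x, hxT⟩ ∈ T.domain) ∧
      (∃ hxS : x ∈ S.domain, S ⟨x, hxS⟩ ∈ S†.domain))
    (hval : ∀ (x : L.domain) (hxT : (x : F) ∈ T†.domain) (hTx : T† ⟨x, hxT⟩ ∈ T.domain)
      (hxS : (x : F) ∈ S.domain) (hSx : S ⟨x, hxS⟩ ∈ S†.domain),
      L x = T ⟨T† ⟨x, hxT⟩, hTx⟩ + S† ⟨S ⟨x, hxS⟩, hSx⟩)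
    (hdomC : ∀ y : G, y ∈ C.domain ↔ ∃ hy : y ∈ S†.domain, S† ⟨y, hy⟩ ∈ S.domain)
    (hvalC : ∀ (y : C.domain) (hy : (y : G) ∈ S†.domain) (hSy : S† ⟨y, hy⟩ ∈ S.domain),
      C y = S ⟨S† ⟨y, hy⟩, hSy⟩)
    (heig_E : ∀ i, ∃ h : (b_E i : E) ∈ A.domain, A ⟨b_E i, h⟩ = ((μ_E i : ℝ) : 𝕜) • (b_E i : E))
    (heig_F : ∀ j, ∃ h : (b_F j : F) ∈ L.domain, L ⟨b_F j, h⟩ = ((μ_F j : ℝ) : 𝕜) • (b_F j : F))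
    (heig_G : ∀ k, ∃ h : (b_G k : G) ∈ C.domain, C ⟨b_G k, h⟩ = ((μ_G k : ℝ) : 𝕜) • (b_G k : G))
    (htend_E : Tendsto μ_E cofinite atTop) (htend_F : Tendsto μ_F cofinite atTop)
    (htend_G : Tendsto μ_G cofinite atTop)
    (hdT' : Dense (T'.domain : Set E')) (hdS' : Dense (S'.domain : Set F')) (hcS' : S'.IsClosed)
    (hST' : LinearMap.range T'.toFun ≤ (LinearMap.ker S'.toFun).map S'.domain.subtype)
    (hdomA' : ∀ x : E', x ∈ A'.domain ↔ ∃ hx : x ∈ T'.domain, T' ⟨x, hx⟩ ∈ T'†.domain)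
    (hvalA' : ∀ (x : A'.domain) (hx : (x : E') ∈ T'.domain) (hTx : T' ⟨x, hx⟩ ∈ T'†.domain),
      A' x = T'† ⟨T' ⟨x, hx⟩, hTx⟩)
    (hdom' : ∀ x : F', x ∈ L'.domain ↔ (∃ hxT : x ∈ T'†.domain, T'† ⟨x, hxT⟩ ∈ T'.domain) ∧
      (∃ hxS : x ∈ S'.domain, S' ⟨x, hxS⟩ ∈ S'†.domain))
    (hval' : ∀ (x : L'.domain) (hxT : (x : F') ∈ T'†.domain) (hTx : T'† ⟨x, hxT⟩ ∈ T'.domain)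
      (hxS : (x : F') ∈ S'.domain) (hSx : S' ⟨x, hxS⟩ ∈ S'†.domain),
      L' x = T' ⟨T'† ⟨x, hxT⟩, hTx⟩ + S'† ⟨S' ⟨x, hxS⟩, hSx⟩)
    (hdomC' : ∀ y : G', y ∈ C'.domain ↔ ∃ hy : y ∈ S'†.domain, S'† ⟨y, hy⟩ ∈ S'.domain)
    (hvalC' : ∀ (y : C'.domain) (hy : (y : G') ∈ S'†.domain) (hSy : S'† ⟨y, hy⟩ ∈ S'.domain),
      C' y = S' ⟨S'† ⟨y, hy⟩, hSy⟩)
    (heig'_E : ∀ i, ∃ h : (b'_E i : E') ∈ A'.domain, A' ⟨b'_E i, h⟩ = ((μ'_E i : ℝ) : 𝕜) • (b'_E i : E'))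
    (heig'_F : ∀ j, ∃ h : (b'_F j : F') ∈ L'.domain, L' ⟨b'_F j, h⟩ = ((μ'_F j : ℝ) : 𝕜) • (b'_F j : F'))
    (heig'_G : ∀ k, ∃ h : (b'_G k : G') ∈ C'.domain, C' ⟨b'_G k, h⟩ = ((μ'_G k : ℝ) : 𝕜) • (b'_G k : G'))
    (htend'_E : Tendsto μ'_E cofinite atTop) (htend'_F : Tendsto μ'_F cofinite atTop)
    (htend'_G : Tendsto μ'_G cofinite atTop)
    (hgT : ∀ (w : E) (hw : w ∈ T.domain), ∃ h : g_E w ∈ T'.domain, T' ⟨g_E w, h⟩ = g_F (T ⟨w, hw⟩))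
    (hgS : ∀ (u : F) (hu : u ∈ S.domain), ∃ h : g_F u ∈ S'.domain, S' ⟨g_F u, h⟩ = g_G (S ⟨u, hu⟩))
    (hkT : ∀ (w' : E') (hw' : w' ∈ T'.domain), ∃ h : k_E w' ∈ T.domain, T ⟨k_E w', h⟩ = k_F (T' ⟨w', hw'⟩))
    (hkS : ∀ (u' : F') (hu' : u' ∈ S'.domain), ∃ h : k_F u' ∈ S.domain, S ⟨k_F u', h⟩ = k_G (S' ⟨u', hu'⟩))
    (hkg_E : ∀ w : E, k_E (g_E w) = w) (hgk_E : ∀ w' : E', g_E (k_E w') = w')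
    (hkg_F : ∀ u : F, k_F (g_F u) = u) (hgk_F : ∀ u' : F', g_F (k_F u') = u')
    (hkg_G : ∀ z : G, k_G (g_G z) = z) (hgk_G : ∀ z' : G', g_G (k_G z') = z')
    {Mg Mk : ℝ} (hMg : 0 < Mg) (hMk : 0 < Mk) (hgE : ∀ w : E, ‖g_E w‖ ≤ Mg * ‖w‖)
    (hgF : ∀ y : F, ‖g_F y‖ ≤ Mg * ‖y‖) (hgG : ∀ z : G, ‖g_G z‖ ≤ Mg * ‖z‖)
    (hkE : ∀ w' : E', ‖k_E w'‖ ≤ Mk * ‖w'‖) (hkF : ∀ y' : F', ‖k_F y'‖ ≤ Mk * ‖y'‖)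
    (hkG : ∀ z' : G', ‖k_G z'‖ ≤ Mk * ‖z'‖) {t : ℝ} (ht : 0 ≤ t)
    (hs_E : Summable fun i ↦ Real.exp (-(t / max ((Mg * Mk) ^ 2) 1 * μ_E i)))
    (hs_F : Summable fun j ↦ Real.exp (-(t / max ((Mg * Mk) ^ 2) 1 * μ_F j)))
    (hs_G : Summable fun k ↦ Real.exp (-(t / max ((Mg * Mk) ^ 2) 1 * μ_G k))) :
    (Summable (fun i ↦ Real.exp (-(t * μ'_E i))) ∧ Summable (fun j ↦ Real.exp (-(t * μ'_F j))) ∧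
      Summable (fun k ↦ Real.exp (-(t * μ'_G k)))) ∧
      ∑' i, Real.exp (-(t * μ'_E i)) + ∑' j, Real.exp (-(t * μ'_F j)) + ∑' k, Real.exp (-(t * μ'_G k)) ≤
        ∑' i, Real.exp (-(t / max ((Mg * Mk) ^ 2) 1 * μ_E i)) +
          ∑' j, Real.exp (-(t / max ((Mg * Mk) ^ 2) 1 * μ_F j)) +
          ∑' k, Real.exp (-(t / max ((Mg * Mk) ^ 2) 1 * μ_G k)) := by
  obtain ⟨hsE, hE⟩ := summable_and_tsum_exp_neg_mul_adjointCompSelf_le_of_iso hdT hdomA hvalA heig_E htend_E hdT'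
    hdomA' hvalA' heig'_E htend'_E hgT hkT hkg_E hgk_E hMg hMk hgE hgF hkE hkF ht hs_E
  obtain ⟨hsF, hF⟩ := summable_and_tsum_exp_neg_mul_laplacian_le_of_iso hdT hdS hcS hST hdomA hvalA hdom hval hdomC
    hvalC heig_E heig_F heig_G htend_E htend_F htend_G hdT' hdS' hcS' hST' hdomA' hvalA' hdom' hval' hdomC' hvalC'
    heig'_E heig'_F heig'_G htend'_E htend'_F htend'_G hgT hgS hkT hkS hkg_E hgk_E hkg_F hgk_F hkg_G hgk_G hMg hMk hgE
    hgF hgG hkE hkF hkG ht hs_F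
  obtain ⟨hsG, hG⟩ := summable_and_tsum_exp_neg_mul_selfCompAdjoint_le_of_iso hdS hdomC hvalC heig_G htend_G hdS'
    hdomC' hvalC' heig'_G htend'_G hgS hkS hkg_G hgk_G hMg hMk hgF hgG hkF hkG ht hs_G
  exact ⟨⟨hsE, hsF, hsG⟩, add_le_add (add_le_add hE hF) hG⟩

/-- **COROLLARY 2.18 (Brüning–Lesch 1992), as printed, for the short complex.** "Assume that the Laplacian `Δ` of
`(𝒟, D)` satisfies `tr e^{-tΔ} ≤ Ct^{-α}` for `0 < t ≤ 1`. If there is a complex isomorphism `g : (𝒟, D) → (𝒟′, D′)`,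
then we have also `tr e^{-tΔ′} ≤ C′t^{-α}`, `0 < t ≤ 1`." Here `Δ = T*T ⊕ □ ⊕ SS*` with eigenbases on both (discrete)
complexes, `tr e^{-tΔ} = θ_E(t) + θ_F(t) + θ_G(t)` (the three series assumed convergent on `(0, t₀]`), the isomorphism
has `‖g‖ ≤ M_g`, `‖k‖ ≤ M_k`, and the conclusion holds with the explicit constant `C′ = K·max((M_g M_k)², 1)^α` on the same
interval `(0, t₀]` (BL92: `t₀ = 1`). [cite: BruningLesch1992, §2 Cor 2.18] -/
theorem heatTrace_complex_le_mul_rpow_neg_of_iso (hdT : Dense (T.domain : Set E))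
    (hdS : Dense (S.domain : Set F)) (hcS : S.IsClosed)
    (hST : LinearMap.range T.toFun ≤ (LinearMap.ker S.toFun).map S.domain.subtype)
    (hdomA : ∀ x : E, x ∈ A.domain ↔ ∃ hx : x ∈ T.domain, T ⟨x, hx⟩ ∈ T†.domain)
    (hvalA : ∀ (x : A.domain) (hx : (x : E) ∈ T.domain) (hTx : T ⟨x, hx⟩ ∈ T†.domain),
      A x = T† ⟨T ⟨x, hx⟩, hTx⟩)
    (hdom : ∀ x : F, x ∈ L.domain ↔ (∃ hxT : x ∈ T†.domain, T† ⟨x, hxT⟩ ∈ T.domain) ∧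
      (∃ hxS : x ∈ S.domain, S ⟨x, hxS⟩ ∈ S†.domain))
    (hval : ∀ (x : L.domain) (hxT : (x : F) ∈ T†.domain) (hTx : T† ⟨x, hxT⟩ ∈ T.domain)
      (hxS : (x : F) ∈ S.domain) (hSx : S ⟨x, hxS⟩ ∈ S†.domain),
      L x = T ⟨T† ⟨x, hxT⟩, hTx⟩ + S† ⟨S ⟨x, hxS⟩, hSx⟩)
    (hdomC : ∀ y : G, y ∈ C.domain ↔ ∃ hy : y ∈ S†.domain, S† ⟨y, hy⟩ ∈ S.domain)
    (hvalC : ∀ (y : C.domain) (hy : (y : G) ∈ S†.domain) (hSy : S† ⟨y, hy⟩ ∈ S.domain),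
      C y = S ⟨S† ⟨y, hy⟩, hSy⟩)
    (heig_E : ∀ i, ∃ h : (b_E i : E) ∈ A.domain, A ⟨b_E i, h⟩ = ((μ_E i : ℝ) : 𝕜) • (b_E i : E))
    (heig_F : ∀ j, ∃ h : (b_F j : F) ∈ L.domain, L ⟨b_F j, h⟩ = ((μ_F j : ℝ) : 𝕜) • (b_F j : F))
    (heig_G : ∀ k, ∃ h : (b_G k : G) ∈ C.domain, C ⟨b_G k, h⟩ = ((μ_G k : ℝ) : 𝕜) • (b_G k : G))
    (htend_E : Tendsto μ_E cofinite atTop) (htend_F : Tendsto μ_F cofinite atTop)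
    (htend_G : Tendsto μ_G cofinite atTop)
    (hdT' : Dense (T'.domain : Set E')) (hdS' : Dense (S'.domain : Set F')) (hcS' : S'.IsClosed)
    (hST' : LinearMap.range T'.toFun ≤ (LinearMap.ker S'.toFun).map S'.domain.subtype)
    (hdomA' : ∀ x : E', x ∈ A'.domain ↔ ∃ hx : x ∈ T'.domain, T' ⟨x, hx⟩ ∈ T'†.domain)
    (hvalA' : ∀ (x : A'.domain) (hx : (x : E') ∈ T'.domain) (hTx : T' ⟨x, hx⟩ ∈ T'†.domain),
      A' x = T'† ⟨T' ⟨x, hx⟩, hTx⟩)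
    (hdom' : ∀ x : F', x ∈ L'.domain ↔ (∃ hxT : x ∈ T'†.domain, T'† ⟨x, hxT⟩ ∈ T'.domain) ∧
      (∃ hxS : x ∈ S'.domain, S' ⟨x, hxS⟩ ∈ S'†.domain))
    (hval' : ∀ (x : L'.domain) (hxT : (x : F') ∈ T'†.domain) (hTx : T'† ⟨x, hxT⟩ ∈ T'.domain)
      (hxS : (x : F') ∈ S'.domain) (hSx : S' ⟨x, hxS⟩ ∈ S'†.domain),
      L' x = T' ⟨T'† ⟨x, hxT⟩, hTx⟩ + S'† ⟨S' ⟨x, hxS⟩, hSx⟩)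
    (hdomC' : ∀ y : G', y ∈ C'.domain ↔ ∃ hy : y ∈ S'†.domain, S'† ⟨y, hy⟩ ∈ S'.domain)
    (hvalC' : ∀ (y : C'.domain) (hy : (y : G') ∈ S'†.domain) (hSy : S'† ⟨y, hy⟩ ∈ S'.domain),
      C' y = S' ⟨S'† ⟨y, hy⟩, hSy⟩)
    (heig'_E : ∀ i, ∃ h : (b'_E i : E') ∈ A'.domain, A' ⟨b'_E i, h⟩ = ((μ'_E i : ℝ) : 𝕜) • (b'_E i : E'))
    (heig'_F : ∀ j, ∃ h : (b'_F j : F') ∈ L'.domain, L' ⟨b'_F j, h⟩ = ((μ'_F j : ℝ) : 𝕜) • (b'_F j : F'))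
    (heig'_G : ∀ k, ∃ h : (b'_G k : G') ∈ C'.domain, C' ⟨b'_G k, h⟩ = ((μ'_G k : ℝ) : 𝕜) • (b'_G k : G'))
    (htend'_E : Tendsto μ'_E cofinite atTop) (htend'_F : Tendsto μ'_F cofinite atTop)
    (htend'_G : Tendsto μ'_G cofinite atTop)
    (hgT : ∀ (w : E) (hw : w ∈ T.domain), ∃ h : g_E w ∈ T'.domain, T' ⟨g_E w, h⟩ = g_F (T ⟨w, hw⟩))
    (hgS : ∀ (u : F) (hu : u ∈ S.domain), ∃ h : g_F u ∈ S'.domain, S' ⟨g_F u, h⟩ = g_G (S ⟨u, hu⟩))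
    (hkT : ∀ (w' : E') (hw' : w' ∈ T'.domain), ∃ h : k_E w' ∈ T.domain, T ⟨k_E w', h⟩ = k_F (T' ⟨w', hw'⟩))
    (hkS : ∀ (u' : F') (hu' : u' ∈ S'.domain), ∃ h : k_F u' ∈ S.domain, S ⟨k_F u', h⟩ = k_G (S' ⟨u', hu'⟩))
    (hkg_E : ∀ w : E, k_E (g_E w) = w) (hgk_E : ∀ w' : E', g_E (k_E w') = w')
    (hkg_F : ∀ u : F, k_F (g_F u) = u) (hgk_F : ∀ u' : F', g_F (k_F u') = u')
    (hkg_G : ∀ z : G, k_G (g_G z) = z) (hgk_G : ∀ z' : G', g_G (k_G z') = z')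
    {Mg Mk : ℝ} (hMg : 0 < Mg) (hMk : 0 < Mk) (hgE : ∀ w : E, ‖g_E w‖ ≤ Mg * ‖w‖)
    (hgF : ∀ y : F, ‖g_F y‖ ≤ Mg * ‖y‖) (hgG : ∀ z : G, ‖g_G z‖ ≤ Mg * ‖z‖)
    (hkE : ∀ w' : E', ‖k_E w'‖ ≤ Mk * ‖w'‖) (hkF : ∀ y' : F', ‖k_F y'‖ ≤ Mk * ‖y'‖)
    (hkG : ∀ z' : G', ‖k_G z'‖ ≤ Mk * ‖z'‖) {K α t₀ : ℝ}
    (hK : ∀ t : ℝ, 0 < t → t ≤ t₀ →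
      (Summable (fun i ↦ Real.exp (-(t * μ_E i))) ∧ Summable (fun j ↦ Real.exp (-(t * μ_F j))) ∧
        Summable (fun k ↦ Real.exp (-(t * μ_G k)))) ∧
      ∑' i, Real.exp (-(t * μ_E i)) + ∑' j, Real.exp (-(t * μ_F j)) + ∑' k, Real.exp (-(t * μ_G k)) ≤
        K * t ^ (-α))
    {t : ℝ} (ht : 0 < t) (ht₀ : t ≤ t₀) :
    (Summable (fun i ↦ Real.exp (-(t * μ'_E i))) ∧ Summable (fun j ↦ Real.exp (-(t * μ'_F j))) ∧
      Summable (fun k ↦ Real.exp (-(t * μ'_G k)))) ∧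
      ∑' i, Real.exp (-(t * μ'_E i)) + ∑' j, Real.exp (-(t * μ'_F j)) + ∑' k, Real.exp (-(t * μ'_G k)) ≤
        K * (max ((Mg * Mk) ^ 2) 1) ^ α * t ^ (-α) := by
  set C₀ : ℝ := max ((Mg * Mk) ^ 2) 1 with hC₀
  have hC1 : 1 ≤ C₀ := le_max_right _ _
  have hC0 : 0 < C₀ := lt_of_lt_of_le one_pos hC1
  obtain ⟨⟨hsE, hsF, hsG⟩, hbd⟩ := hK (t / C₀) (div_pos ht hC0) ((div_le_self ht.le hC1).trans ht₀)
  obtain ⟨hs', hle⟩ := heatTrace_complex_le_of_iso hdT hdS hcS hST hdomA hvalA hdom hval hdomC hvalC heig_E heig_F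
    heig_G htend_E htend_F htend_G hdT' hdS' hcS' hST' hdomA' hvalA' hdom' hval' hdomC' hvalC' heig'_E heig'_F heig'_G
    htend'_E htend'_F htend'_G hgT hgS hkT hkS hkg_E hgk_E hkg_F hgk_F hkg_G hgk_G hMg hMk hgE hgF hgG hkE hkF hkG ht.le
    hsE hsF hsG
  exact ⟨hs', hle.trans (hbd.trans_eq (mul_div_rpow_neg_eq ht.le hC0.le))⟩

end Middle

end Literature.Analysis.InnerProduct
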